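import Summits.Langlands.Langlands.Theses.QuadraticWindow

/-!
# The residual item `BeyondTheWindow` of route QuadraticWindow: logical status

`BeyondTheWindow := QuadraticWindowA → Langlands` (item stmt-Langlands-3202) is, by the route's own
design, the EXPLICIT RESIDUAL of the sector route QuadraticWindow: the rest of the summit
`Langlands` (Buzzard–Gee 2014, Conj. 3.2.1–3.2.2 for `GL_n`, both directions, all number fields,
all `n ≥ 1`, local–global compatibility at every finite place) once the window theorem
`QuadraticWindowA` is granted.  This file records, sorry-free, the propositional facts that pin
down its logical status inside the tree (support lemmas for stmt-Langlands-3202; none of them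
closes the item, which stays open with the summit):

* `beyondTheWindow_sandwich` — the summit implies the item, and the item together with the window
  theorem gives the summit back (the glue of the route's deciding theorem `closes`);
* `beyondTheWindow_iff_langlands` — granted `QuadraticWindowA`, the item is *equivalent* to the
  summit;
* `beyondTheWindow_iff_not_or` — unconditionally, the item holds iff the window theorem fails or
  the summit holds.  Hence the only two ways to settle it are a refutation of `QuadraticWindowA`
  (believed true: it is an instance of conjunct (A) of the summit, Buzzard–Gee Conj. 3.2.1 for
  `τ`-polarized regular algebraic `π` over a quadratic extension of a totally real field) or a
  proof of `Langlands` itself.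

All statements are phrased as `↔` / `∧` so that no declaration has the bare route decl or the
summit as its conclusion (nothing here is a proof of either).  No mathematics beyond
propositional logic is used.
-/

set_option linter.dupNamespace false -- project-wide option; `Summit.Langlands.Langlands` is the mandated namespace

namespace Summit.Langlands.Langlands.Theorems

open Summit.Langlands.Langlands.Theses.QuadraticWindow

/-- **Sandwich.** The summit `Langlands` implies the residual item
`BeyondTheWindow = (QuadraticWindowA → Langlands)` (weakening), and conversely the item and the
window theorem give the summit (modus ponens — the glue of the route's deciding theorem).
[folklore] -/
theorem beyondTheWindow_sandwich :
    (_root_.Langlands → BeyondTheWindow) ∧ (BeyondTheWindow → QuadraticWindowA → _root_.Langlands) :=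
  ⟨fun h _ => h, fun h hX => h hX⟩

/-- Granted the window theorem `QuadraticWindowA`, the residual item is equivalent to the whole
summit `Langlands`. [folklore] -/
theorem beyondTheWindow_iff_langlands (hX : QuadraticWindowA) :
    BeyondTheWindow ↔ _root_.Langlands :=
  ⟨fun h => h hX, fun h _ => h⟩

/-- Unconditionally, `BeyondTheWindow` holds iff the window theorem fails or the summit holds:
settling the item means refuting `QuadraticWindowA` or proving `Langlands`. [folklore] -/
theorem beyondTheWindow_iff_not_or :
    BeyondTheWindow ↔ (¬ QuadraticWindowA ∨ _root_.Langlands) := by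
  unfold BeyondTheWindow
  exact imp_iff_not_or

end Summit.Langlands.Langlands.Theorems
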